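import Summits.FinalStateConjecture.FinalStateConjecture.Theorems.DrainImpliesDisperse.Negative.DrainImpliesDisperseFalseOfProperPulsedObserver
import Summits.FinalStateConjecture.FinalStateConjecture.Theses.NoNullFinalMomentum
import HarnessLib

/-!
# Crux `DrainImpliesDisperse` (stmt-FinalStateConjecture-17283), negative side: the `Iff.rfl` twin
# `NoNullFinalMomentum.DrainImpliesDisperse`

The statement item stmt-FinalStateConjecture-17283 is SHARED by two routes: it closes
`Theses.BondiDrainDispersal.DrainImpliesDisperse` (rank 2 of route BondiDrainDispersal) and
`Theses.NoNullFinalMomentum.DrainImpliesDisperse` (rank 2 of route NoNullFinalMomentum, a hypothesis of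
that route's deciding theorem `closes : DrainImpliesDisperse → GenericMassiveSettle → FinalStateConjecture`).
The two route decls are the same proposition letter for letter (refuter rattack-17283: `Iff.rfl`). The two
negative lemmas of the regularity channel landed by lead c4 —
`DrainImpliesDisperse_false_of_pulsedObserverDevelopmentExists` (p155615, modulo
`H = PulsedObserverDevelopmentExists`) and `DrainImpliesDisperse_false_of_properPulsedObserverDevelopmentExists`
(p157410, modulo the primitive `H' = ProperPulsedObserverDevelopmentExists`: a drained censored MGHD of an
admissible datum carrying a persistently pulsed, ray-borne, all-seeing future timelike observer, whose
entire `C²`-asymptotically flat future-oriented late charts are eventually proper) — are stated against the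
BondiDrainDispersal copy only. This file records the identity of the two copies and transports both negative
lemmas to the NoNullFinalMomentum copy, so that the second route's planner sees the same finding on its own
decl: AS FILED (Dafermos–Rodnianski data class, `C²` conclusion on entire `N = 0` slabs) the shared crux is
decided by far-field regularity bookkeeping (`Cruxes/DrainImpliesDisperse/REPORT-c3.md` §5: repair C′ =
Christodoulou–Klainerman class data; REPORT-c4.md; REPORT-c5.md). Line lead
`prover-line-stmt-FinalStateConjecture-17283-c5-0`, 2026-08-17.
-/

noncomputable section

-- D-0017: single-problem summit, `Summit.<S>.<S>.…` by design (cf. lakefile `weak.linter.dupNamespace`).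
set_option linter.dupNamespace false

namespace Summit.FinalStateConjecture.FinalStateConjecture.Theorems.DrainImpliesDisperse.Negative.NoNullFinalMomentum

/-- **The two route copies of the shared crux are the same proposition.**
`Theses.NoNullFinalMomentum.DrainImpliesDisperse` and `Theses.BondiDrainDispersal.DrainImpliesDisperse`
have syntactically identical bodies (item stmt-FinalStateConjecture-17283, `shared_closes`); refuter
rattack-17283 recorded the `Iff.rfl`. [folklore] -/
theorem drainImpliesDisperse_iff :
    Theses.NoNullFinalMomentum.DrainImpliesDisperse ↔ Theses.BondiDrainDispersal.DrainImpliesDisperse :=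
  Iff.rfl

/-- **Negative lemma for the NoNullFinalMomentum copy, modulo `ProperPulsedObserverDevelopmentExists`**:
one drained censored maximal development of one admissible datum carrying a persistently pulsed, ray-borne,
all-seeing observer, in which asymptotically flat entire late charts are eventually proper, falsifies
`NoNullFinalMomentum.DrainImpliesDisperse` as filed (transport of
`DrainImpliesDisperse_false_of_properPulsedObserverDevelopmentExists`, p157410, along `Iff.rfl`). [folklore] -/
theorem DrainImpliesDisperse_false_of_properPulsedObserverDevelopmentExists
    (H : ProperPulsedObserverDevelopmentExists) : ¬ Theses.NoNullFinalMomentum.DrainImpliesDisperse :=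
  fun h ↦ Negative.DrainImpliesDisperse_false_of_properPulsedObserverDevelopmentExists H
    (drainImpliesDisperse_iff.mp h)

/-- **Negative lemma for the NoNullFinalMomentum copy, modulo `PulsedObserverDevelopmentExists`** (the
achronality form `H` of the witness; transport of `DrainImpliesDisperse_false_of_pulsedObserverDevelopmentExists`,
p155615, along `Iff.rfl`). [folklore] -/
theorem DrainImpliesDisperse_false_of_pulsedObserverDevelopmentExists
    (H : PulsedObserverDevelopmentExists) : ¬ Theses.NoNullFinalMomentum.DrainImpliesDisperse :=
  fun h ↦ Negative.DrainImpliesDisperse_false_of_pulsedObserverDevelopmentExists H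
    (drainImpliesDisperse_iff.mp h)

end Summit.FinalStateConjecture.FinalStateConjecture.Theorems.DrainImpliesDisperse.Negative.NoNullFinalMomentum

end
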